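import Summits.QuantumFields.YangMills.Theorems.BalabanUVNodesN15TwoSpacingGluingCurvedKnitCovariantAveraging
import Summits.QuantumFields.YangMills.Theorems.BalabanUVNodesN15CovariantLandauFlat
import Summits.QuantumFields.YangMills.Theorems.BalabanUVNodesN15CovariantAveragingGauge
import Summits.QuantumFields.YangMills.Theorems.BalabanUVNodesN15AdjointGaugeAction
import HarnessLib

/-!
# THE GLUING STEP AT TWO LATTICE SPACINGS — PROGRAMME (P-R), VI: THE FULLY COVARIANT SUMMAND `P(U) = a·Q*(U)Q(U) − D_U(I − R(U))D*_U` OF (3.26) ON THE COVER, ITS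
# LANDAU PERTURBATION LETTER `N_V^R`, AND FILE 120's CONJUGATION ROW `hP` DISCHARGED WITH THE PER-CUBE GAUGES LIVE (dag-n15-c g22, n15-c∕201; N15 = NE2, s1)

Cell `pub-ymgap`, seat `pub-ymgap-dag-n15-c` (R134 (a); HUMAN RULING D-0062), generation 22.  `bears_on: R4∕N15 · K3⁸ SpineGivenEndpointR13SepCoPHV (stmt-QuantumFields-27366)`.
Filed `--supports stmt-QuantumFields-27366 --as helper` — COUNT-NEUTRAL.  Four plumbing `def`s (`cvT₀`, `cvLandau`, `cvNVr`, `cvGauge`) + theorems; 0 `sorry`; NO estimate.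
Imports BY NAME n15-c∕183 `…CurvedKnitCovariantAveraging` (`cvT`, `cvNVq`, `cvNL_sub_cvNVq`; through it FILE 119's `cvNL`∕`CvX`∕`cvM`), n15-c∕200 `…CovariantLandauFlat`
(`landauCov_one_eq`; through it 197 `landauCov`, 198 `gaugeT`∕`gaugeTb`∕`bdiag`∕`landauCov_gauge`), n15-c∕201a `…CovariantAveragingGauge` (`qvCovAdj_comp_qvCov_gauge`), the lane's
`…N15AdjointGaugeAction` (`uN_siteGauge_orthogonal`, `uN_siteGauge_transpose_eq`, `coordMat_mulLeftRight_mul`).  Nothing in the tree modified ∕ restated.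

WHY (HOME HANDOFF g16 «THE FINDING» + g21).  FILE 120 `uN_cvGlued_spec` builds the glued inverse of `Δ_{R_U} + P` from dressed cubes in PER-CUBE gauges `u_k`, provided the summand
satisfies the conjugation row `hP : ∀ k, M_{W_k}·P·M_{W_kᵀ} = N_L ⊗ 1 − N_V k`.  With the flat `P = N_L ⊗ 1` (FILES 129–180) or the half-covariant `P = N_L ⊗ 1 − N_V^Q`
(n15-c∕181–196) that row is producible only for the GLOBAL gauge `u ≡ 1`.  THIS FILE completes Bałaban's `P(U)` ([Balaban1985BackgroundPropagators] (3.26) p. 395) in the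
model — `P(U) := a·Q*(U)Q(U) − D_U(I − R(U))D*_U = N_L ⊗ 1 − N_V^Q − N_V^R` with the LANDAU PERTURBATION LETTER `N_V^R := D_U(I − R(U))D*_U − ∂Π∂* ⊗ 1_ι` (zero at `U ≡ 1` by
n15-c∕200) — and DISCHARGES `hP` FOR LIVE `u_k`: by (3.31)–(3.34) in the model (n15-c∕198 `landauCov_gauge`, n15-c∕201a `qvCovAdj_comp_qvCov_gauge`),
`M_{W_k}·P(U)·M_{W_kᵀ} = P(U^{u_k}) = N_L ⊗ 1 − (N_V^Q + N_V^R)(U^{u_k})`, i.e. `hP` holds with `N_V k := (N_V^Q + N_V^R)(U^{u_k})` — the perturbation READ IN THE CUBE's OWN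
GAUGE, where `U^{u_k} = e^{iηA_k}` is small on `□̃_k` by (3.35).  What remains displayed for the sequel are the size ∕ decay rows of `N_V^R(U^{u_k})` near and far from the cube
(`hNVcut`, `hfarN` of 120; = the content of [Balaban1985BackgroundPropagators] Thms 3.2–3.3), NOT this file.

OBJECTS AND RESULTS ([folklore] algebra unless tagged; equation tags mark the printed formula an object transcribes).
* §1 `cvT₀ e U` (the SITE transporter datum `coordMat e Ad_{U_ν(x)}` read off the knit's bond-point field at its own component), ★ `cvLandau` (`D_U(I−R(U))D*_U` on the cover
  = `mulVecLin (landauCov (cvT₀ e U) a)`), ★ `cvNVr` (`N_V^R := cvLandau − landauRe ⊗ 1_ι`), `cvGauge u U` (the knit's action `u(p)·U_μ(p)·u(p + e_μ)ᴴ` of FILE 120's `gaugePair`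
  argument), ★★ `cvNL_sub_cvNVq_sub_cvNVr` (THE FULLY COVARIANT SUMMAND: `N_L ⊗ 1 − N_V^Q − N_V^R = a·Q*(U)Q(U) − D_U(I−R(U))D*_U`), `cvT₀_one`, ★★ `cvNVr_one : N_V^R(1) = 0`
  (n15-c∕200 «coincides with Δ_a in (2.19) if U = 1»).
* §2 `mmulOp_eq_mulVecLin_bdiag`, `cvT_gauge`∕`cvT₀_gauge` (the knit's action IS n15-c∕198's `gaugeTb`∕`gaugeT` in `Ad`-coordinates), ★★ `cvLandau_gauge`
  (`M_W·D(I−R)D*(U)·M_{Wᵀ} = D(I−R)D*(U^u)`), ★★ `cvAvg_gauge` (the same for `Q*(U)Q(U)`), ★★★ **`cv_hP_live`** (FILE 120's `hP` with LIVE per-cube gauges: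
  `∀ k, M_{W_k}·(N_L⊗1 − N_V^Q(U) − N_V^R(U))·M_{W_kᵀ} = N_L⊗1 − (N_V^Q + N_V^R)(U^{u_k})`).

HONEST FRAMING ∕ LIMITS.  Algebra + definitions; NO estimate: the rows `hNVcut`∕`hfarN`∕(123's) `hDNV` for `N_V^R` are NOT produced here (they are [B9] Thms 3.2–3.3's content in
the model; the sequel displays them).  MODEL READING as n15-c∕181∕197 (one averaging level, whole torus, uniform weights in `Δ′_a`, one-level staircases, `Q(U)` = main term
(125), site ∕ component-blind gauges and site transporters read at the bond's own component).  NOT [Balaban1985BackgroundPropagators] Thm 3.1∕3.14 as printed; NE2⁺ NOT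
PRINTED; N15 of record untouched (DISCHARGED AS CONSUMED, p687738); counts UNMOVED (typed 28∕28); one finite 𝕋⁴ at fixed ε per index — NOT infinite volume ∕ OS ∕ mass gap ∕ Clay.
Restate-immune (no Theses import).
-/

noncomputable section

open scoped BigOperators Matrix

namespace Summit.QuantumFields.YangMills.BalabanUVNodes.N15.Gluing

open Literature.MathematicalPhysics.QuantumFieldTheory.Balaban1983to89
open Literature.MathematicalPhysics.QuantumFieldTheory.Balaban1983to89.B5Prop11Plancherel (Tor fine unitVec)
open Literature.Barriers.QuantumFields (traceForm)
open Summit.QuantumFields.YangMills.BalabanUVNodes.N15.VectorPiece (bshiftEquiv bshiftEquiv_apply tensorId tensorId_apply)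
open Summit.QuantumFields.YangMills.BalabanUVNodes.N15.MatrixSpecies (mmulOp mmulOp_apply coordMat)
open Summit.QuantumFields.YangMills.BalabanUVNodes.N15.CurvedSpecies (uN_siteGauge_orthogonal uN_siteGauge_transpose_eq coordMat_mulLeftRight_mul coordMat_conj_one mmulOp_transpose_comp)
open Summit.QuantumFields.YangMills.BalabanUVNodes.N15.TwoGrid (qvRe qvAdjRe landauRe)
open Summit.QuantumFields.YangMills.BalabanUVNodes.N15.CovAvg (qvCov qvCovAdj qvCovAdj_comp_qvCov_gauge)
open Summit.QuantumFields.YangMills.BalabanUVNodes.N15.CovLandau (landauCov gaugeT gaugeTb bdiag landauCov_gauge landauCov_one_eq)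

variable {d : ℕ}

/-! ## §1 The site transporter datum, the covariant Landau term on the cover, the Landau perturbation letter, the fully covariant summand -/

section Objects

open scoped Matrix.Norms.L2Operator

variable {mm : Type} [Fintype mm] [DecidableEq mm] {ι : Type} [Fintype ι] [DecidableEq ι] {L : ℕ} [NeZero L]

/-- THE SITE TRANSPORTER DATUM read off a bond-point field at the bond's own component: `(cvT₀ e U) ν x = coordMat e Ad_{U_ν(x, ν)}`.
[cite: Balaban1985BackgroundPropagators, (3.23) p.394, (3.50) p.400 («R(U(b))»: shape)] -/
def cvT₀ {M : Fin (d + 1) → ℕ} [∀ μ, NeZero (M μ)] {n : ℕ} [NeZero n] (e : Matrix mm mm ℂ ≃L[ℝ] (ι → ℝ)) (U : Fin (d + 1) → Tor (fine n M) × Fin (d + 1) → Matrix mm mm ℂ) :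
    Fin (d + 1) → Tor (fine n M) → Matrix ι ι ℝ :=
  fun ν x => coordMat e (ContinuousLinearMap.mulLeftRight ℝ (Matrix mm mm ℂ) (U ν (x, ν)) (U ν (x, ν))ᴴ)

variable (d) (L : ℕ) [NeZero L]

/-- ★ **THE COVARIANT LANDAU TERM `D_U(I − R(U))D*_U` ON THE COVER's coloured 1-forms** (n15-c∕197's `landauCov` at the site datum of `U`, as a linear map).
[cite: Balaban1985BackgroundPropagators, (3.25)–(3.26) pp.394–395 (shape)] -/
def cvLandau (mv kk : ℕ) (hL : Odd L ∧ 1 < L) (a : ℝ) (ι : Type) [Fintype ι] [DecidableEq ι] (e : Matrix mm mm ℂ ≃L[ℝ] (ι → ℝ)) (U : Fin (d + 1) → CvX d L mv kk hL → Matrix mm mm ℂ) :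
    (CvX d L mv kk hL × ι → ℝ) →ₗ[ℝ] (CvX d L mv kk hL × ι → ℝ) :=
  Matrix.mulVecLin (landauCov (cvM d L mv kk hL) (L ^ kk) (cvT₀ e U) a)

/-- ★ **THE LANDAU PERTURBATION LETTER `N_V^R := D_U(I − R(U))D*_U − ∂Π∂* ⊗ 1_ι`** (covariant minus flat; zero at `U ≡ 1`). [cite: Balaban1985BackgroundPropagators, (3.26) p.395; Balaban1984PropagatorsI, (1.69) p.29] -/
def cvNVr (mv kk : ℕ) (hL : Odd L ∧ 1 < L) (a : ℝ) (ι : Type) [Fintype ι] [DecidableEq ι] (e : Matrix mm mm ℂ ≃L[ℝ] (ι → ℝ)) (U : Fin (d + 1) → CvX d L mv kk hL → Matrix mm mm ℂ) :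
    (CvX d L mv kk hL × ι → ℝ) →ₗ[ℝ] (CvX d L mv kk hL × ι → ℝ) :=
  cvLandau d L mv kk hL a ι e U - tensorId ι (landauRe (cvM d L mv kk hL) (L ^ kk))

/-- THE KNIT's GAUGE ACTION on a bond-point field (the argument of FILE 120's `gaugePair`): `(U^u)_μ(p) = u(p)·U_μ(p)·u(p + e_μ)ᴴ`. [cite: Balaban1985BackgroundPropagators, (3.28) p.395] -/
def cvGauge (mv kk : ℕ) (hL : Odd L ∧ 1 < L) (u : CvX d L mv kk hL → Matrix mm mm ℂ) (U : Fin (d + 1) → CvX d L mv kk hL → Matrix mm mm ℂ) :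
    Fin (d + 1) → CvX d L mv kk hL → Matrix mm mm ℂ :=
  fun μ p => u p * U μ p * (u (bshiftEquiv (cvM d L mv kk hL) (L ^ kk) μ p))ᴴ

variable {d L}

/-- ★★ **THE FULLY COVARIANT SUMMAND OF (3.26) IN THE MODEL**: `N_L ⊗ 1 − N_V^Q − N_V^R = a·Q*(U)Q(U) − D_U(I − R(U))D*_U`. [cite: Balaban1985BackgroundPropagators, (3.26) p.395] -/
theorem cvNL_sub_cvNVq_sub_cvNVr (mv kk : ℕ) (hL : Odd L ∧ 1 < L) (a : ℝ) (e : Matrix mm mm ℂ ≃L[ℝ] (ι → ℝ)) (U : Fin (d + 1) → CvX d L mv kk hL → Matrix mm mm ℂ) :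
    cvNL d L mv kk hL a ι - cvNVq d L mv kk hL a ι e U - cvNVr d L mv kk hL a ι e U =
      a • (qvCovAdj (cvM d L mv kk hL) (L ^ kk) (cvT e U) ∘ₗ qvCov (cvM d L mv kk hL) (L ^ kk) (cvT e U)) - cvLandau d L mv kk hL a ι e U := by
  rw [cvNL_sub_cvNVq, cvNVr]
  have h : tensorId ι (-landauRe (cvM d L mv kk hL) (L ^ kk)) = -tensorId ι (landauRe (cvM d L mv kk hL) (L ^ kk)) := by
    refine LinearMap.ext fun f => funext fun p => ?_
    simp only [tensorId_apply, LinearMap.neg_apply, Pi.neg_apply]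
  rw [h]
  abel

/-- At `U ≡ 1` the site datum is `1`. [folklore] -/
theorem cvT₀_one {M : Fin (d + 1) → ℕ} [∀ μ, NeZero (M μ)] {n : ℕ} [NeZero n] (e : Matrix mm mm ℂ ≃L[ℝ] (ι → ℝ)) :
    cvT₀ e (fun (_ : Fin (d + 1)) (_ : Tor (fine n M) × Fin (d + 1)) => (1 : Matrix mm mm ℂ)) = fun _ _ => 1 := by
  funext ν x
  simp only [cvT₀]
  exact coordMat_conj_one e

/-- ★★ **THE LANDAU PERTURBATION LETTER VANISHES AT `U ≡ 1`** (`a > 0`): n15-c∕200's «coincides with Δ_a in (2.19) if U = 1» on the cover.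
[cite: Balaban1985BackgroundPropagators, (3.26) p.395; Balaban1984PropagatorsI, (1.69) p.29] -/
theorem cvNVr_one (mv kk : ℕ) (hL : Odd L ∧ 1 < L) {a : ℝ} (ha : 0 < a) (e : Matrix mm mm ℂ ≃L[ℝ] (ι → ℝ)) :
    cvNVr d L mv kk hL a ι e (fun _ _ => (1 : Matrix mm mm ℂ)) = 0 := by
  rw [cvNVr, cvLandau, cvT₀_one, landauCov_one_eq _ _ ha, sub_self]

end Objects

/-! ## §2 The conjugation row `hP` of FILE 120 with the per-cube gauges LIVE -/

section Gauge

open scoped Matrix.Norms.L2Operator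

variable {mm : Type} [Fintype mm] [DecidableEq mm] {ι : Type} [Fintype ι] [DecidableEq ι] {L : ℕ} [NeZero L]

omit [Fintype mm] [DecidableEq mm] [DecidableEq ι] in
/-- The lane's colour action `mmulOp C` is the matrix `bdiag C` of n15-c∕198. [folklore] -/
theorem mmulOp_eq_mulVecLin_bdiag {X : Type} [Fintype X] [DecidableEq X] (C : X → Matrix ι ι ℝ) : mmulOp C = Matrix.mulVecLin (bdiag C) := by
  refine LinearMap.ext fun f => funext fun p => ?_
  rw [mmulOp_apply, Matrix.mulVecLin_apply]
  simp only [Matrix.mulVec, dotProduct, bdiag, Fintype.sum_prod_type, ite_mul, zero_mul]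
  rw [Finset.sum_eq_single p.1 (fun x _ hx => by simp [Ne.symm hx]) (fun h => (h (Finset.mem_univ _)).elim)]
  simp only [if_true]

omit [NeZero L] in
/-- THE KNIT's ACTION ON THE BOND-INDEXED TRANSPORTERS IS n15-c∕198's `gaugeTb` in `Ad`-coordinates: for a unitary SITE gauge `u₀` lifted to the bond points,
`cvT e (U^{u₀}) = gaugeTb (coordMat e Ad_{u₀}) (cvT e U)`. [cite: Balaban1985BackgroundPropagators, (3.28) p.395, (3.32) p.395] -/
theorem cvT_gauge (mv kk : ℕ) (hL : Odd L ∧ 1 < L) (e : Matrix mm mm ℂ ≃L[ℝ] (ι → ℝ)) (he : ∀ A B : Matrix mm mm ℂ, traceForm A B = e A ⬝ᵥ e B)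
    {u₀ : Tor (fine (L ^ kk) (cvM d L mv kk hL)) → Matrix mm mm ℂ} (hu : ∀ x, (u₀ x)ᴴ * u₀ x = 1) (U : Fin (d + 1) → CvX d L mv kk hL → Matrix mm mm ℂ) :
    cvT e (cvGauge d L mv kk hL (fun p => u₀ p.1) U) =
      gaugeTb (cvM d L mv kk hL) (L ^ kk) (fun x => coordMat e (ContinuousLinearMap.mulLeftRight ℝ (Matrix mm mm ℂ) (u₀ x) (u₀ x)ᴴ)) (cvT e U) := by
  -- the lane's (Frobenius-scoped) `uN_siteGauge_transpose_eq`, re-elaborated in this scope by defeq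
  have hT : ∀ x, (coordMat e (ContinuousLinearMap.mulLeftRight ℝ (Matrix mm mm ℂ) (u₀ x) (u₀ x)ᴴ))ᵀ = coordMat e (ContinuousLinearMap.mulLeftRight ℝ (Matrix mm mm ℂ) (u₀ x)ᴴ (u₀ x)) :=
    fun x => uN_siteGauge_transpose_eq e u₀ he hu x
  funext μ p
  simp only [cvT, cvGauge, gaugeTb, bshiftEquiv_apply]
  rw [hT, coordMat_mulLeftRight_mul, coordMat_mulLeftRight_mul, Matrix.conjTranspose_mul, Matrix.conjTranspose_mul, Matrix.conjTranspose_conjTranspose]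

/-- The same for the SITE datum: `cvT₀ e (U^{u₀}) = gaugeT (coordMat e Ad_{u₀}) (cvT₀ e U)`. [cite: Balaban1985BackgroundPropagators, (3.28) p.395, (3.31) p.395] -/
theorem cvT₀_gauge (mv kk : ℕ) (hL : Odd L ∧ 1 < L) (e : Matrix mm mm ℂ ≃L[ℝ] (ι → ℝ)) (he : ∀ A B : Matrix mm mm ℂ, traceForm A B = e A ⬝ᵥ e B)
    {u₀ : Tor (fine (L ^ kk) (cvM d L mv kk hL)) → Matrix mm mm ℂ} (hu : ∀ x, (u₀ x)ᴴ * u₀ x = 1) (U : Fin (d + 1) → CvX d L mv kk hL → Matrix mm mm ℂ) :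
    cvT₀ e (cvGauge d L mv kk hL (fun p => u₀ p.1) U) =
      gaugeT (cvM d L mv kk hL) (L ^ kk) (fun x => coordMat e (ContinuousLinearMap.mulLeftRight ℝ (Matrix mm mm ℂ) (u₀ x) (u₀ x)ᴴ)) (cvT₀ e U) := by
  have hT : ∀ x, (coordMat e (ContinuousLinearMap.mulLeftRight ℝ (Matrix mm mm ℂ) (u₀ x) (u₀ x)ᴴ))ᵀ = coordMat e (ContinuousLinearMap.mulLeftRight ℝ (Matrix mm mm ℂ) (u₀ x)ᴴ (u₀ x)) :=
    fun x => uN_siteGauge_transpose_eq e u₀ he hu x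
  funext ν x
  simp only [cvT₀, cvGauge, gaugeT, bshiftEquiv_apply]
  rw [hT, coordMat_mulLeftRight_mul, coordMat_mulLeftRight_mul, Matrix.conjTranspose_mul, Matrix.conjTranspose_mul, Matrix.conjTranspose_conjTranspose]

/-- ★★ **(3.34) FOR THE LANDAU SUMMAND ON THE COVER**: `M_W ∘ D_U(I−R(U))D*_U ∘ M_{Wᵀ} = D_{U^u}(I−R(U^u))D*_{U^u}` for a unitary site gauge `u₀` (`W = coordMat e Ad_{u₀}` at the
bond's base point). [cite: Balaban1985BackgroundPropagators, (3.34) p.396] -/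
theorem cvLandau_gauge (mv kk : ℕ) (hL : Odd L ∧ 1 < L) (a : ℝ) (e : Matrix mm mm ℂ ≃L[ℝ] (ι → ℝ)) (he : ∀ A B : Matrix mm mm ℂ, traceForm A B = e A ⬝ᵥ e B)
    {u₀ : Tor (fine (L ^ kk) (cvM d L mv kk hL)) → Matrix mm mm ℂ} (hu : ∀ x, (u₀ x)ᴴ * u₀ x = 1) (U : Fin (d + 1) → CvX d L mv kk hL → Matrix mm mm ℂ) :
    mmulOp (fun p : CvX d L mv kk hL => coordMat e (ContinuousLinearMap.mulLeftRight ℝ (Matrix mm mm ℂ) (u₀ p.1) (u₀ p.1)ᴴ)) ∘ₗ cvLandau d L mv kk hL a ι e U ∘ₗ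
        mmulOp (fun p : CvX d L mv kk hL => (coordMat e (ContinuousLinearMap.mulLeftRight ℝ (Matrix mm mm ℂ) (u₀ p.1) (u₀ p.1)ᴴ))ᵀ) =
      cvLandau d L mv kk hL a ι e (cvGauge d L mv kk hL (fun p => u₀ p.1) U) := by
  have hW : ∀ x, (coordMat e (ContinuousLinearMap.mulLeftRight ℝ (Matrix mm mm ℂ) (u₀ x) (u₀ x)ᴴ))ᵀ * coordMat e (ContinuousLinearMap.mulLeftRight ℝ (Matrix mm mm ℂ) (u₀ x) (u₀ x)ᴴ) = 1 :=
    fun x => (uN_siteGauge_orthogonal e u₀ he hu x).2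
  rw [cvLandau, cvLandau, cvT₀_gauge mv kk hL e he hu, landauCov_gauge _ _ hW, mmulOp_eq_mulVecLin_bdiag, mmulOp_eq_mulVecLin_bdiag, ← CovLandau.bdiag_transpose,
    ← Matrix.mulVecLin_mul, ← Matrix.mulVecLin_mul, Matrix.mul_assoc]

/-- ★★ **(3.32)–(3.34) FOR THE AVERAGING SUMMAND ON THE COVER**: `M_W ∘ Q*(U)Q(U) ∘ M_{Wᵀ} = Q*(U^u)Q(U^u)`. [cite: Balaban1985BackgroundPropagators, (3.32) p.395, p.396 l.1–3] -/
theorem cvAvg_gauge (mv kk : ℕ) (hL : Odd L ∧ 1 < L) (e : Matrix mm mm ℂ ≃L[ℝ] (ι → ℝ)) (he : ∀ A B : Matrix mm mm ℂ, traceForm A B = e A ⬝ᵥ e B)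
    {u₀ : Tor (fine (L ^ kk) (cvM d L mv kk hL)) → Matrix mm mm ℂ} (hu : ∀ x, (u₀ x)ᴴ * u₀ x = 1) (U : Fin (d + 1) → CvX d L mv kk hL → Matrix mm mm ℂ) :
    mmulOp (fun p : CvX d L mv kk hL => coordMat e (ContinuousLinearMap.mulLeftRight ℝ (Matrix mm mm ℂ) (u₀ p.1) (u₀ p.1)ᴴ)) ∘ₗ
        (qvCovAdj (cvM d L mv kk hL) (L ^ kk) (cvT e U) ∘ₗ qvCov (cvM d L mv kk hL) (L ^ kk) (cvT e U)) ∘ₗ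
        mmulOp (fun p : CvX d L mv kk hL => (coordMat e (ContinuousLinearMap.mulLeftRight ℝ (Matrix mm mm ℂ) (u₀ p.1) (u₀ p.1)ᴴ))ᵀ) =
      qvCovAdj (cvM d L mv kk hL) (L ^ kk) (cvT e (cvGauge d L mv kk hL (fun p => u₀ p.1) U)) ∘ₗ qvCov (cvM d L mv kk hL) (L ^ kk) (cvT e (cvGauge d L mv kk hL (fun p => u₀ p.1) U)) := by
  have hW : ∀ x, (coordMat e (ContinuousLinearMap.mulLeftRight ℝ (Matrix mm mm ℂ) (u₀ x) (u₀ x)ᴴ))ᵀ * coordMat e (ContinuousLinearMap.mulLeftRight ℝ (Matrix mm mm ℂ) (u₀ x) (u₀ x)ᴴ) = 1 :=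
    fun x => (uN_siteGauge_orthogonal e u₀ he hu x).2
  rw [cvT_gauge mv kk hL e he hu, qvCovAdj_comp_qvCov_gauge _ _ hW]

/-- ★★★ **FILE 120's CONJUGATION ROW `hP` WITH THE PER-CUBE GAUGES LIVE**: for unitary site gauges `u₀ k` (lifted to the bond points) and trace-form-orthonormal `e`, the fully
covariant summand `P(U) = N_L ⊗ 1 − N_V^Q(U) − N_V^R(U)` satisfies `M_{W_k}·P(U)·M_{W_kᵀ} = N_L ⊗ 1 − (N_V^Q + N_V^R)(U^{u_k})` for every cube `k` — the row `hP` of `uN_cvGlued_spec`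
with `N_V k := N_V^Q(U^{u_k}) + N_V^R(U^{u_k})` (the perturbation read in the cube's own gauge). [cite: Balaban1985BackgroundPropagators, (3.26) p.395, (3.31)–(3.34) pp.395–396, (3.62)–(3.65) pp.402–403 (mechanism)] -/
theorem cv_hP_live (mv kk : ℕ) (hL : Odd L ∧ 1 < L) (a : ℝ) (e : Matrix mm mm ℂ ≃L[ℝ] (ι → ℝ)) (he : ∀ A B : Matrix mm mm ℂ, traceForm A B = e A ⬝ᵥ e B)
    {K : Type} {u₀ : K → Tor (fine (L ^ kk) (cvM d L mv kk hL)) → Matrix mm mm ℂ} (hu : ∀ k x, (u₀ k x)ᴴ * u₀ k x = 1) (U : Fin (d + 1) → CvX d L mv kk hL → Matrix mm mm ℂ) (k : K) :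
    mmulOp (fun p : CvX d L mv kk hL => coordMat e (ContinuousLinearMap.mulLeftRight ℝ (Matrix mm mm ℂ) (u₀ k p.1) (u₀ k p.1)ᴴ)) ∘ₗ
        (cvNL d L mv kk hL a ι - cvNVq d L mv kk hL a ι e U - cvNVr d L mv kk hL a ι e U) ∘ₗ
        mmulOp (fun p : CvX d L mv kk hL => (coordMat e (ContinuousLinearMap.mulLeftRight ℝ (Matrix mm mm ℂ) (u₀ k p.1) (u₀ k p.1)ᴴ))ᵀ) =
      cvNL d L mv kk hL a ι - (cvNVq d L mv kk hL a ι e (cvGauge d L mv kk hL (fun p => u₀ k p.1) U) + cvNVr d L mv kk hL a ι e (cvGauge d L mv kk hL (fun p => u₀ k p.1) U)) := by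
  rw [show cvNL d L mv kk hL a ι - (cvNVq d L mv kk hL a ι e (cvGauge d L mv kk hL (fun p => u₀ k p.1) U) + cvNVr d L mv kk hL a ι e (cvGauge d L mv kk hL (fun p => u₀ k p.1) U)) =
      cvNL d L mv kk hL a ι - cvNVq d L mv kk hL a ι e (cvGauge d L mv kk hL (fun p => u₀ k p.1) U) - cvNVr d L mv kk hL a ι e (cvGauge d L mv kk hL (fun p => u₀ k p.1) U) from
      (sub_sub _ _ _).symm,
    cvNL_sub_cvNVq_sub_cvNVr, cvNL_sub_cvNVq_sub_cvNVr, ← cvAvg_gauge mv kk hL e he (hu k) U, ← cvLandau_gauge mv kk hL a e he (hu k) U, LinearMap.sub_comp, LinearMap.comp_sub,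
    LinearMap.smul_comp, LinearMap.comp_smul]

end Gauge

end Summit.QuantumFields.YangMills.BalabanUVNodes.N15.Gluing

end
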